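import Summits.CriticalPhenomena.PercolationContinuityZ3.Theorems.PercNearOneGluingNoHeavyLowerTailThreePartitionRowColumn

/-!
# `NoHeavyLowerTail` (crux stmt-CriticalPhenomena-4575): FACT R — in every row the `T3` deficiency of Conjecture V's kernel is
# attained by the WHOLE row (it equals the Kleitman slack `κ` of the row cube)

Support file (lineage `prim-bnk-2`, generation 29; `--supports stmt-CriticalPhenomena-4575`; memo
`run/shared/lean/prim/prim-l12/FROM-prim-bnk-2-g29-DECOUPLED-HALL.md` §2).  No `sorry`, standard axioms, no new definitions.

The ROW units of the kernel `K = T1+T2+T3` of Conjecture V (`…ThreePartitionVOrder`, `…ThreePartitionRowColumn`, `…ThreePartitionDecoupled`) are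
`T3⁻ = #(c∈𝒱𝒲, b∉𝒲)` and `T3⁺ = #(c∈𝒱∖𝒲, b∈𝒲)`; they are moved inside rows (`a` fixed, `b` grows).  In a row `a` (cube `S = ι∖a`,
reflection `b ↔ c`) the sources are `σ𝒱 ∩ L_𝒲` and the targets `σ𝒱 ∩ H_𝒲` (`σ𝒱 = {b : c ∈ 𝒱}` a DOWN-set), so the row is a Kleitman–Hall
system RESTRICTED TO A DOWN-SET and generally has a deficit.

**Theorem (`rowDeficit_le_total`, "FACT R").**  For all up-sets `𝒱, 𝒲`, every twist and every ROW-CLOSED family `𝒳` (all row sections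
`{b : (a,b) ∈ 𝒳}` up-sets):  `T3⁻(𝒳) − T3⁺(𝒳) ≤ T3⁻(all) − T3⁺(all)` (`= Σ_rows κ_a(𝒱;𝒲)`).  Equivalently (`rowPosUnits_le_rowNegUnits_of_lowerSections`)
on a family with DOWN-set row sections the positive row units are outnumbered by the negative ones.  So in each row the Hall deficiency of
`T3⁻ → T3⁺` is exactly the row's Kleitman slack `κ`, the worst up-set is the whole row, every maximum row matching SATURATES `T3⁺`, and for any
Kleitman–Hall bijection `g` of the row cube the unmatched sources are exactly its "`𝒱`-breakers" (memo §2; census (ROWMAX): Conjecture V's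
coupling is always solvable with exactly `κ` units leaving each row).  Proof: Kleitman on each folding fibre for the DECREASING family
`b ∉ 𝒳_a ∧ c ∈ 𝒱` against the up-set `𝒲` (`fibre_card_dec_and_up_le`: Daykin twice with fibre-local monotonicity, as in
`FoldingFibre.fibreCount_le_of_isUpperSet_isLowerSet`). [this work]
-/

namespace Summit.CriticalPhenomena.PercolationContinuityZ3.Theorems.ThreePartition

open Finset Function
open scoped symmDiff Classical

noncomputable section

variable {ι : Type*} [Fintype ι]


open Literature.Probability.Percolation.FoldingFibre in
/-- **Kleitman on a folding fibre with fibre-local monotonicity**: if `Q` is DECREASING along `⊆` inside the fibre `F = {a : a \ M = u}`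
and `W` is an up-set, then `#{a ∈ F : Q a, a ∈ W} ≤ #{a ∈ F : Q a, a ∆ M ∈ W}` — a decreasing family meets the up-set `W` at most as often
as it meets the reflected copy of `W`.  (Daykin twice on the fibre, as in `FoldingFibre.fibreCount_le_of_isUpperSet_isLowerSet`, but with the
monotonicity of `Q` required on the fibre only.) [this work] -/
theorem fibre_card_dec_and_up_le (M u : Set ι) (Q : Set ι → Prop)
    (hQ : ∀ a ∈ fibre M u, ∀ b ∈ fibre M u, a ⊆ b → Q b → Q a)
    {W : Set (Set ι)} (hW : IsUpperSet W) :
    ((fibre M u).filter fun a => Q a ∧ a ∈ W).card ≤ ((fibre M u).filter fun a => Q a ∧ a ∆ M ∈ W).card := by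
  set F := fibre M u with hF
  have hPW : ∀ a ∈ F, ∀ b ∈ F, a ⊆ b → a ∈ W → b ∈ W := fun a _ b _ hab ha => hW hab ha
  -- step 1 (up-set `W` against the decreasing `Q`): `#(W ∧ Q)·#F ≤ #W · #Q`
  have h1 := card_filter_and_mul_card_le M u (fun a => a ∈ W) Q hPW hQ
  -- step 2 (two up-sets, after reflecting): `P'(a) := Q (a ∆ M)` is increasing on the fibre
  have hP' : ∀ a ∈ F, ∀ b ∈ F, a ⊆ b → Q (a ∆ M) → Q (b ∆ M) := fun a ha b hb hab h =>
    hQ _ (symmDiff_mem_fibre hb) _ (symmDiff_mem_fibre ha) (symmDiff_subset_symmDiff_of_subset ha hb hab) h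
  have h3 := card_filter_mul_card_filter_le M u (fun a => Q (a ∆ M)) (fun a => a ∈ W) hP' hPW
  -- reflections: `#{Q(a∆M)} = #{Q}` and `#{Q(a∆M) ∧ a ∈ W} = #{Q a ∧ a∆M ∈ W}`
  have r1 : (F.filter fun a => Q (a ∆ M)).card = (F.filter fun a => Q a).card := by
    have := card_filter_symmDiff_mem M u {a | Q a}
    simpa only [Set.mem_setOf_eq] using this
  have r2 : (F.filter fun a => Q (a ∆ M) ∧ a ∈ W).card = (F.filter fun a => Q a ∧ a ∆ M ∈ W).card := by
    refine Finset.card_bij' (fun (a : Set ι) _ => a ∆ M) (fun (a : Set ι) _ => a ∆ M) ?_ ?_ ?_ ?_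
    · intro a ha
      rw [Finset.mem_filter] at ha ⊢
      refine ⟨symmDiff_mem_fibre ha.1, ha.2.1, ?_⟩
      rw [symmDiff_symmDiff_cancel_right]; exact ha.2.2
    · intro a ha
      rw [Finset.mem_filter] at ha ⊢
      refine ⟨symmDiff_mem_fibre ha.1, ?_, ha.2.2⟩
      rw [symmDiff_symmDiff_cancel_right]; exact ha.2.1
    · intro a _; exact symmDiff_symmDiff_cancel_right M a
    · intro a _; exact symmDiff_symmDiff_cancel_right M a
  rw [← hF] at h1 h3
  rw [r1, r2] at h3
  have e1 : (F.filter fun a => a ∈ W ∧ Q a).card = (F.filter fun a => Q a ∧ a ∈ W).card := by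
    congr 1; ext a; simp only [Finset.mem_filter]; tauto
  rw [e1] at h1
  have h4 : (F.filter fun a => Q a ∧ a ∈ W).card * F.card ≤ F.card * (F.filter fun a => Q a ∧ a ∆ M ∈ W).card :=
    calc (F.filter fun a => Q a ∧ a ∈ W).card * F.card
        ≤ (F.filter fun a => a ∈ W).card * (F.filter fun a => Q a).card := h1
      _ = (F.filter fun a => Q a).card * (F.filter fun a => a ∈ W).card := Nat.mul_comm _ _
      _ ≤ F.card * (F.filter fun a => Q a ∧ a ∆ M ∈ W).card := h3
  rcases Nat.eq_zero_or_pos F.card with hF0 | hFpos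
  · have : (F.filter fun a => Q a ∧ a ∈ W).card = 0 :=
      Nat.eq_zero_of_le_zero ((Finset.card_le_card (Finset.filter_subset _ F)).trans hF0.le)
    rw [this]; exact Nat.zero_le _
  · rw [Nat.mul_comm F.card] at h4
    exact Nat.le_of_mul_le_mul_right h4 hFpos

open Literature.Probability.Percolation.FoldingFibre in
/-- **FACT R (complement form)**: on a family `𝒴` whose ROW sections `{b : (a,b) ∈ 𝒴}` are DOWN-sets, the positive row units are outnumbered by
the negative ones: `T3⁺(𝒴) ≤ T3⁻(𝒴)`.  (In each row fibre, `b ∉ 𝒳_a ∧ c ∈ 𝒱` is decreasing in `b`; then Kleitman on the fibre for the up-set `𝒲`.)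
[this work] -/
theorem rowPosUnits_le_rowNegUnits_of_lowerSections (τ : Set ι) {𝒱 𝒲 : Set (Set ι)} {𝒴 : Set (Set ι × Set ι)}
    (h𝒱 : IsUpperSet 𝒱) (h𝒲 : IsUpperSet 𝒲) (h𝒴 : ∀ a : Set ι, IsLowerSet {b : Set ι | (a, b) ∈ 𝒴}) :
    triT τ (fun a b c => (a, b) ∈ 𝒴 ∧ (c ∈ 𝒱 ∧ c ∉ 𝒲) ∧ b ∈ 𝒲) ≤ triT τ (fun a b c => (a, b) ∈ 𝒴 ∧ (c ∈ 𝒱 ∧ c ∈ 𝒲) ∧ b ∉ 𝒲) := by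
  -- add the common count `#(𝒴, c∈𝒱, c∈𝒲, b∈𝒲)` to both sides
  have s1 := triT_and_add_triT_and_not τ (fun a b c => (a, b) ∈ 𝒴 ∧ c ∈ 𝒱 ∧ b ∈ 𝒲) (fun _ _ c => c ∈ 𝒲)
  have s2 := triT_and_add_triT_and_not τ (fun a b c => (a, b) ∈ 𝒴 ∧ c ∈ 𝒱 ∧ c ∈ 𝒲) (fun _ b _ => b ∈ 𝒲)
  have e12 : triT τ (fun a b c => ((a, b) ∈ 𝒴 ∧ c ∈ 𝒱 ∧ b ∈ 𝒲) ∧ c ∈ 𝒲) =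
      triT τ (fun a b c => ((a, b) ∈ 𝒴 ∧ c ∈ 𝒱 ∧ c ∈ 𝒲) ∧ b ∈ 𝒲) := triT_congr fun a b c => by tauto
  have eP : triT τ (fun a b c => ((a, b) ∈ 𝒴 ∧ c ∈ 𝒱 ∧ b ∈ 𝒲) ∧ ¬ c ∈ 𝒲) = triT τ (fun a b c => (a, b) ∈ 𝒴 ∧ (c ∈ 𝒱 ∧ c ∉ 𝒲) ∧ b ∈ 𝒲) := by
    exact triT_congr fun a b c => by tauto
  have eN : triT τ (fun a b c => ((a, b) ∈ 𝒴 ∧ c ∈ 𝒱 ∧ c ∈ 𝒲) ∧ ¬ b ∈ 𝒲) = triT τ (fun a b c => (a, b) ∈ 𝒴 ∧ (c ∈ 𝒱 ∧ c ∈ 𝒲) ∧ b ∉ 𝒲) := by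
    exact triT_congr fun a b c => by tauto
  rw [e12, eP] at s1
  rw [eN] at s2
  -- the fibrewise inequality `#(𝒴, c∈𝒱, b∈𝒲) ≤ #(𝒴, c∈𝒱, c∈𝒲)`
  have key : triT τ (fun a b c => (a, b) ∈ 𝒴 ∧ c ∈ 𝒱 ∧ b ∈ 𝒲) ≤ triT τ (fun a b c => (a, b) ∈ 𝒴 ∧ c ∈ 𝒱 ∧ c ∈ 𝒲) := by
    rw [triT_eq_sum_fst, triT_eq_sum_fst]
    refine sum_le_sum fun S _ => ?_
    have hQ : ∀ a ∈ fibre Sᶜ (S ∩ τ), ∀ b ∈ fibre Sᶜ (S ∩ τ), a ⊆ b →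
        ((S ∆ τ, b) ∈ 𝒴 ∧ b ∆ Sᶜ ∈ 𝒱) → ((S ∆ τ, a) ∈ 𝒴 ∧ a ∆ Sᶜ ∈ 𝒱) :=
      fun a ha b hb hab h => ⟨h𝒴 (S ∆ τ) hab h.1, h𝒱 (symmDiff_subset_symmDiff_of_subset ha hb hab) h.2⟩
    have h := fibre_card_dec_and_up_le Sᶜ (S ∩ τ) (fun b => (S ∆ τ, b) ∈ 𝒴 ∧ b ∆ Sᶜ ∈ 𝒱) hQ h𝒲
    refine le_trans (le_of_eq (congrArg Finset.card ?_)) (le_trans h (le_of_eq (congrArg Finset.card ?_)))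
    · ext b; simp only [mem_filter, mem_univ, true_and, fibre]; tauto
    · ext b; simp only [mem_filter, mem_univ, true_and, fibre]; tauto
  omega

/-- **FACT R**: on every ROW-CLOSED family `𝒳` (row sections up-sets) the row deficit `T3⁻(𝒳) − T3⁺(𝒳)` is at most the TOTAL row deficit
`T3⁻ − T3⁺` over all faces (`= Σ_rows κ`): in each row the whole row is the worst up-set, i.e. the Hall deficiency of `T3⁻ → T3⁺` in a row is exactly
the Kleitman slack `κ` of that row's cube, and every maximum row matching saturates `T3⁺`. [this work] -/
theorem rowDeficit_le_total (τ : Set ι) {𝒱 𝒲 : Set (Set ι)} {𝒳 : Set (Set ι × Set ι)}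
    (h𝒱 : IsUpperSet 𝒱) (h𝒲 : IsUpperSet 𝒲) (h𝒳 : ∀ a : Set ι, IsUpperSet {b : Set ι | (a, b) ∈ 𝒳}) :
    (triT τ (fun a b c => (a, b) ∈ 𝒳 ∧ (c ∈ 𝒱 ∧ c ∈ 𝒲) ∧ b ∉ 𝒲) : ℤ) - triT τ (fun a b c => (a, b) ∈ 𝒳 ∧ (c ∈ 𝒱 ∧ c ∉ 𝒲) ∧ b ∈ 𝒲) ≤
      (triT τ (fun _ b c => (c ∈ 𝒱 ∧ c ∈ 𝒲) ∧ b ∉ 𝒲) : ℤ) - triT τ (fun _ b c => (c ∈ 𝒱 ∧ c ∉ 𝒲) ∧ b ∈ 𝒲) := by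
  have hc : ∀ a : Set ι, IsLowerSet {b : Set ι | (a, b) ∈ 𝒳ᶜ} := fun a b b' hle hb hb' => hb (h𝒳 a hle hb')
  have h := rowPosUnits_le_rowNegUnits_of_lowerSections τ h𝒱 h𝒲 hc
  have sN := triT_and_add_triT_and_not τ (fun a b c => (a, b) ∈ (Set.univ : Set (Set ι × Set ι)) ∧ (c ∈ 𝒱 ∧ c ∈ 𝒲) ∧ b ∉ 𝒲)
    (fun a b _ => (a, b) ∈ 𝒳)
  have sP := triT_and_add_triT_and_not τ (fun a b c => (a, b) ∈ (Set.univ : Set (Set ι × Set ι)) ∧ (c ∈ 𝒱 ∧ c ∉ 𝒲) ∧ b ∈ 𝒲)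
    (fun a b _ => (a, b) ∈ 𝒳)
  have eN1 : triT τ (fun a b c => ((a, b) ∈ (Set.univ : Set (Set ι × Set ι)) ∧ (c ∈ 𝒱 ∧ c ∈ 𝒲) ∧ b ∉ 𝒲) ∧ (a, b) ∈ 𝒳) =
      triT τ (fun a b c => (a, b) ∈ 𝒳 ∧ (c ∈ 𝒱 ∧ c ∈ 𝒲) ∧ b ∉ 𝒲) := triT_congr fun a b c => by simp only [Set.mem_univ, true_and]; tauto
  have eN2 : triT τ (fun a b c => ((a, b) ∈ (Set.univ : Set (Set ι × Set ι)) ∧ (c ∈ 𝒱 ∧ c ∈ 𝒲) ∧ b ∉ 𝒲) ∧ ¬ (a, b) ∈ 𝒳) =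
      triT τ (fun a b c => (a, b) ∈ 𝒳ᶜ ∧ (c ∈ 𝒱 ∧ c ∈ 𝒲) ∧ b ∉ 𝒲) := triT_congr fun a b c => by simp only [Set.mem_univ, true_and, Set.mem_compl_iff]; tauto
  have eP1 : triT τ (fun a b c => ((a, b) ∈ (Set.univ : Set (Set ι × Set ι)) ∧ (c ∈ 𝒱 ∧ c ∉ 𝒲) ∧ b ∈ 𝒲) ∧ (a, b) ∈ 𝒳) =
      triT τ (fun a b c => (a, b) ∈ 𝒳 ∧ (c ∈ 𝒱 ∧ c ∉ 𝒲) ∧ b ∈ 𝒲) := triT_congr fun a b c => by simp only [Set.mem_univ, true_and]; tauto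
  have eP2 : triT τ (fun a b c => ((a, b) ∈ (Set.univ : Set (Set ι × Set ι)) ∧ (c ∈ 𝒱 ∧ c ∉ 𝒲) ∧ b ∈ 𝒲) ∧ ¬ (a, b) ∈ 𝒳) =
      triT τ (fun a b c => (a, b) ∈ 𝒳ᶜ ∧ (c ∈ 𝒱 ∧ c ∉ 𝒲) ∧ b ∈ 𝒲) := triT_congr fun a b c => by simp only [Set.mem_univ, true_and, Set.mem_compl_iff]; tauto
  have eN0 : triT τ (fun a b c => (a, b) ∈ (Set.univ : Set (Set ι × Set ι)) ∧ (c ∈ 𝒱 ∧ c ∈ 𝒲) ∧ b ∉ 𝒲) =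
      triT τ (fun _ b c => (c ∈ 𝒱 ∧ c ∈ 𝒲) ∧ b ∉ 𝒲) := triT_congr fun a b c => by simp only [Set.mem_univ, true_and]
  have eP0 : triT τ (fun a b c => (a, b) ∈ (Set.univ : Set (Set ι × Set ι)) ∧ (c ∈ 𝒱 ∧ c ∉ 𝒲) ∧ b ∈ 𝒲) =
      triT τ (fun _ b c => (c ∈ 𝒱 ∧ c ∉ 𝒲) ∧ b ∈ 𝒲) := triT_congr fun a b c => by simp only [Set.mem_univ, true_and]
  rw [eN1, eN2, eN0] at sN
  rw [eP1, eP2, eP0] at sP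
  omega

end

end Summit.CriticalPhenomena.PercolationContinuityZ3.Theorems.ThreePartition
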